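/-
Copyright (c) 2026 the pub-hodgecm-mathlib formalisation cell (harness21).  Prover seat hodgecm-mathlib-K2E3-p26 (g3), Track B «K2-LIT»,
#184♮ = hLiu418 = `stmt-HodgeConjecture-24832`; socket #41, KIND W — LEAD F0P6-plan (g15) BATCH #216 (KW-fin-OF-RECORD): THE (iii-fin) LETTER PACKAGE OF RECORD —
the support exponents `Tc c hc`, the support letter `hsuppLoc` and the size letter `k₂ k₃ Tβ hsizeLoc` of ★ p863724 `kindW_block_cm_of_localLetters_haar` (its bytes :145–:161
at `n := 2`), from the ★ per-letter payers, for ONE `obtain` at the tie.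
THEOREMS ONLY (no `def`, no `instance`, no notation, no named-fact hypothesis, no `sorry`); lane `--supports stmt-HodgeConjecture-24832` (count-neutral helper).
-/
import Summits.HodgeConjecture.HodgeConjecture.Theorems.K2LiuKindWFactorLevelInvariance      -- ★ p863964 (this seat): §4 `FvT_mul_mul_evalPlace_eq` (the `hFinv` body in LEVEL currency), §3's output shape `(cL, hlevInv)`
import Summits.HodgeConjecture.HodgeConjecture.Theorems.K2LiuKindWFiniteSupportLetterOfLevel  -- ★ p863876 (K2E3-p03 (g9)) `hsuppLoc_of_level_guarded`; brings ★ p863154 `kindWFfin`, `kindWLocalBall`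
import Summits.HodgeConjecture.HodgeConjecture.Theorems.K2LiuKindWFiniteSizeLetterOfPlace     -- ★ p863720 (K2Liu-p26 (g3)) `hsizeLoc_of_place`
import Summits.HodgeConjecture.HodgeConjecture.Theorems.K2LiuKindWFiniteDualLatticeLetter     -- ★ p863825 (F0P2-p09 (g2)) (ζ) `hdual_of_exponent_letter`
import Summits.HodgeConjecture.HodgeConjecture.Theorems.K2LiuKindWFiniteConductorLetters      -- ★ (θ) (K2E3-p34 (g3)) `exists_conductorLetters`, `hdom_of_conductorLetters`
import Summits.HodgeConjecture.HodgeConjecture.Theorems.K2LiuKindOneSingularCornerTraceLetter -- ★ `gramR_apply_ne_zero` (`T^R_{kk} ≠ 0` from `hdV0 hdW0`)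
import Summits.HodgeConjecture.HodgeConjecture.Theorems.K2LiuKindWCarrierHaarVolume         -- ★ (V) p864002 (K2Liu-p26 (g3)) `hvol_of_haar`
import HarnessLib

/-!
# Crux `HLiu418`, socket #41, KIND W — `K2LiuKindWFiniteLettersOfRecord`: THE (iii-fin) LETTERS `Tc c hc hsuppLoc k₂ k₃ Tβ hsizeLoc` OF THE KIND-W HEAD, PACKAGED

Cell `hodgecm-mathlib`, crux item hLiu418 = `stmt-HodgeConjecture-24832` (helper lane `--supports … --as helper`, count-neutral), route of record `HCCMUnconditional`;
squad K2 ∕ K2Liu, road `K2_Liu`, socket #41 `sig_K2LiuSiegelEisensteinContinuation`, KIND W, (iii-fin) row; author K2E3-p26 (g3); LEAD F0P6-plan (g15).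
THE HEAD ★ p863724 `kindW_block_cm_of_localLetters_haar` takes fourteen (iii-fin) letters BY VALUE (:142–:161): the SHARED level data `lev Tδ₀ δ₀ hδ₀ k hlev`, the support
exponents `Tc c hc`, the per-place SUPPORT letter `hsuppLoc` and the per-place SIZE letter `k₂ k₃ Tβ hsizeLoc`, all at the finite letter of record
`Ffin j S h v s := if det ↑S = 0 then 0 else kindWFfin … j S h v s` (the GUARDED reading; 📤 p863658 §3, K2E3-typ3 (g2) (KW-fin-probe) v4, K2E3-typ2 (g2) v30 :246).
THIS FILE assembles the last eight from the ★ per-letter payers, hypothesis-first on exactly the letters still in flight: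
* `hsuppLoc` := ★ p863876 `hsuppLoc_of_level_guarded` at the level data `(lev, c, a₀)`, whose two by-value letters are paid here:
  `hFinv` (level-invariance of the local factor on the ball `kindWLocalBall v (π v) (a₀ h v)`) := ★ p863964 §4 `FvT_mul_mul_evalPlace_eq` (this seat) ∘ the (ι) letters
  `hA` (local heights `H_w(h) ≤ q_w^{A h w}`) and `hball` (ball ⇒ level `cL w + 2·A h w`) ∘ the level `(cL, hlevInv)` of the (KW-fac) reading (★ p863964 §3's output, BY VALUE —
  it is shared with (ι) and with the radius-stability payer); `hdual` := ★ (ζ) p863825 `hdual_of_exponent_letter` ∘ ★ (θ) `exists_conductorLetters` + `hdom_of_conductorLetters`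
  ∘ the (ι) reading `ha₀ : e(w|v)·a₀ h v ≤ lev h w`; `T^R_{kk} ≠ 0` ★ `gramR_apply_ne_zero`.  `(Tc, c)` := (θ)'s conductor ∕ defect exponents.
* `hsizeLoc` := ★ p863720 `hsizeLoc_of_place` with `k₂ := (dν + b₁)·a₂`, `k₃ := (dν + b₁)·a₃`, `Tβ := Tβ ∪ Tν ∪ Tρ ∪ Tδ₀`, over the per-place letters (V) `hvol` (Haar volume of the
  balls — PAID by ★ p864002 `hvol_of_haar` from the carriers' normalisation `hνK`), (R) `hstab` (radius-stability), (B) `hsup` (sup on the balls) — by value, payers K2E3-p06 (g7), K2E3-p03 (g10).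
BY VALUE HERE (binders, each with its payer): the (ι) letters `A a₀ lev Tδ₀ δ₀ hδ₀ k hlev hA ha₀ hball` (K2Liu-p13 (g5) `exists_levelLetters`, in flight — ED. 2 of this file
consumes it BY NAME and then concludes all fourteen letters); `(ϖ, hϖ, cL, hlevInv)` (★ p863964 `exists_levels_forall_FvT_mul_eq`, obtained ONCE at the tie); (R)(B).
* §1 **`hFinv_of_levelLetters`** — ★ p863876's binder `hFinv` from `(cL, hlevInv, A, hA, a₀, hball)`.
* §2 HEAD **`kindW_finite_letters_of_record`** ⊢ `∃ Tc c, (∀ w ∉ Tc, c w = 0) ∧ ‹hsuppLoc› ∧ ∃ k₂ k₃ Tβ, ‹hsizeLoc›` (the head's bytes :145–:161 at `n := 2` and the tie's `Ffin`).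
TIE: `obtain ⟨Tc, c, hc, hsuppLoc, k₂, k₃, Tβ, hsizeLoc⟩ := kindW_finite_letters_of_record … hνK … lev Tδ₀ δ₀ hδ₀ k hlev hA ha₀ hball …`; row 2 of `@hKW` unchanged.
[KudlaRallis1994, §2]; [Shimura1997, §18.4 Prop. 18.14]; [Casselman1980, §3]; [BorelJacquet1979, §4.1]; [HarishChandra1999, §17]; [Tate1950, §2.2].

HONEST LABEL.  Count-neutral helper; it retires nothing by itself: `HC_CM` is proved only modulo the 7 printed citations (2 remaining named inputs:
hLiu418 = `stmt-HodgeConjecture-24832`, h413 = `stmt-HodgeConjecture-24833`) until rung 0 closes.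

## References
* [KudlaRallis1994] S. Kudla, S. Rallis, *A regularized Siegel–Weil formula: the first term identity*, Ann. of Math. 140 (1994), §2 (support and size of local Whittaker functions).
* [Shimura1997] G. Shimura, *Euler products and Eisenstein series*, CBMS 93 (1997), §18.4 Prop. 18.14 (dual lattice of a Fourier index).
* [Casselman1980] W. Casselman, *The unramified principal series of p-adic groups I*, Compositio Math. 40 (1980), §3 (smooth vectors, levels).
* [BorelJacquet1979] A. Borel, H. Jacquet, Proc. Sympos. Pure Math. 33.1 (1979), §1.2, §4.1 (heights, levels).
* [HarishChandra1999] Harish-Chandra (DeBacker–Sally, eds.), ULS 16 (1999), §17 (conjugating levels by bounded elements).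
* [Tate1950] J. Tate, *Fourier analysis in number fields and Hecke's zeta-functions* (1950), §2.2 (local additive characters, conductors).
-/

set_option autoImplicit false
-- the mandated namespace repeats the single-problem summit's segment (`HodgeConjecture.HodgeConjecture`)
set_option linter.dupNamespace false

noncomputable section

open scoped Matrix RestrictedProduct ENNReal NNReal Topology ComplexConjugate BigOperators WithZero
-- the `if det ↑S = 0` guard of the reading of record and the finite unions of place sets use the classical instances (as ★ p863720 ∕ ★ p863876)
open scoped Classical
open NumberField IsDedekindDomain MeasureTheory Measure Filter Set Matrix ValuativeRel
open Literature.NumberTheory.Automorphic hiding IsKFinite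
open Literature.NumberTheory.Automorphic.UnitaryGroup Literature.NumberTheory.GaloisRepresentations
open Literature.NumberTheory.GelbartRogawski1991 Literature.NumberTheory.GelbartRogawski1991.GRConstruction
open Literature.NumberTheory.GelbartRogawski1991.UnitaryDualPair Literature.NumberTheory.GelbartRogawski1991.UnitaryDualPair.LocalSplitting
open Literature.NumberTheory.K2Lit Literature.NumberTheory.K2Lit.SiegelDoubled Literature.NumberTheory.K2Lit.LocalSiegelDoubled Literature.NumberTheory.K2Lit.PlaceSplitting
open Summit.HodgeConjecture.HodgeConjecture.Cruxes.HLiu418.K2LiuSiegelUnipotentLocalDefs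
open Summit.HodgeConjecture.HodgeConjecture.Cruxes.HLiu418.K2LiuSiegelUnipotentFourierDefs
open Summit.HodgeConjecture.HodgeConjecture.Cruxes.HLiu418.K2LiuSiegelEisensteinKindWLetters (kindWFinset)
open Summit.HodgeConjecture.HodgeConjecture.Cruxes.HLiu418.K2LiuKindWFiniteLetterDefs (kindWFfin kindWLocalBall)
open Summit.HodgeConjecture.HodgeConjecture.Cruxes.HLiu418.K2LiuKindWFactorLevelInvariance (FvT_mul_mul_evalPlace_eq)
open Summit.HodgeConjecture.HodgeConjecture.Cruxes.HLiu418.K2LiuKindWFiniteSupportLetterOfLevel (hsuppLoc_of_level_guarded)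
open Summit.HodgeConjecture.HodgeConjecture.Cruxes.HLiu418.K2LiuKindWFiniteSizeLetterOfPlace (hsizeLoc_of_place)
open Summit.HodgeConjecture.HodgeConjecture.Cruxes.HLiu418.K2LiuKindWFiniteDualLatticeLetter (hdual_of_exponent_letter)
open Summit.HodgeConjecture.HodgeConjecture.Cruxes.HLiu418.K2LiuKindWFiniteConductorLetters (exists_conductorLetters hdom_of_conductorLetters)
open Summit.HodgeConjecture.HodgeConjecture.Cruxes.HLiu418.K2LiuKindOneSingularCornerTraceLetter (gramR_apply_ne_zero)
open Summit.HodgeConjecture.HodgeConjecture.Cruxes.HLiu418.K2LiuKindWCarrierHaarVolume (hvol_of_haar)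
open Literature.MeasureTheory.RestrictedProduct
open Literature.Topology.Algebra.RestrictedProduct (inH)

namespace Summit.HodgeConjecture.HodgeConjecture.Cruxes.HLiu418.K2LiuKindWFiniteLettersOfRecord

variable (L : Type) [Field L] [NumberField L] [IsCMField L]
variable {N M : ℕ} (e : Fin N × Fin M ≃ Fin 2)
  (dV : Fin N → L) (hdV : ∀ i, IsCMField.complexConj L (dV i) = dV i) (hdV0 : ∀ i, dV i ≠ 0)
  (dW : Fin M → L) (hdW : ∀ i, IsCMField.complexConj L (dW i) = dW i) (hdW0 : ∀ i, dW i ≠ 0)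
variable [∀ v : HeightOneSpectrum (𝓞 (Fp L)), MeasurableSpace ↥(unipDeltaLoc L e dV hdV dW hdW v)]
  [∀ v : HeightOneSpectrum (𝓞 (Fp L)), BorelSpace ↥(unipDeltaLoc L e dV hdV dW hdW v)]

/-! ## §1 The level-invariance letter `hFinv` of ★ p863876 from the level letters -/

omit [∀ v : HeightOneSpectrum (𝓞 (Fp L)), MeasurableSpace ↥(unipDeltaLoc L e dV hdV dW hdW v)]
  [∀ v : HeightOneSpectrum (𝓞 (Fp L)), BorelSpace ↥(unipDeltaLoc L e dV hdV dW hdW v)] in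
set_option maxHeartbeats 800000 in -- MEASURED class (★ p863154 §3 ∕ ★ p863876's 800 000): each `evalPlace v (finPart ·)` translate in `localPi` costs ≈ 3·10⁴ beats at `whnf` of the binder (statement ×4, goal rewrite, ★ §4's instantiation); 400 000 fails, 800 000 passes; no search tactics
/-- **`hFinv` FROM THE LEVEL LETTERS** (★ p863876 `hsuppLoc_of_level_guarded`'s binder, token for token): on the ball `kindWLocalBall v (π v) (a₀ h v)` the local factor at `h` is
right-invariant, `FvT j S h v s (W_v·ι(y u₀)·h_v) = FvT j S h v s (W_v·ι(y)·h_v)` — because the ball lies in the level `∏_{w∣v} K_w(ϖ_w^{cL w + 2·A h w})` (`hball`, the (ι) letter),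
`H_w(h) ≤ q_w^{A h w}` (`hA`), and the reading has level `cL` (`hlevInv`, ★ p863964 §3): ★ p863964 §4 `FvT_mul_mul_evalPlace_eq` at `y := W_v·ι(y)`, `k := ι(u₀)`, `x := h`.
[cite: Casselman1980, §3] [cite: HarishChandra1999, §17] [cite: BorelJacquet1979, §4.1] -/
theorem hFinv_of_levelLetters (T₀ : Finset (HeightOneSpectrum (𝓞 (Fp L))))
    (π : ∀ v : HeightOneSpectrum (𝓞 (Fp L)), v.adicCompletion (Fp L)) {m : ℕ}
    (FvT : Fin m → ∀ (S : skewMatrices ((IsCMField.complexConj L : L ≃ₐ[Fp L] L) : L →+* L) ((gramR L e dV hdV dW hdW).map (algebraMap (Fp L) L)))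
      (h : HA L e dV hdV dW hdW) (v : (kindWFinset L e dV hdV dW hdW T₀ (S : Matrix (Fin 2) (Fin 2) L) h)),
      ℂ → UnitaryGroup.localPi L (IsCMField.complexConj L) (2 + 2) (hermD L e dV hdV dW hdW) v.1 → ℂ)
    -- the level of the reading (★ p863964 §3's output, by value)
    (ϖ : (w : HeightOneSpectrum (𝓞 L)) → w.adicCompletion L) (hϖ : ∀ w, Valued.v (ϖ w) = WithZero.exp (-1 : ℤ)) (cL : HeightOneSpectrum (𝓞 L) → ℕ)
    (hlevInv : ∀ (j : Fin m) (S : skewMatrices ((IsCMField.complexConj L : L ≃ₐ[Fp L] L) : L →+* L) ((gramR L e dV hdV dW hdW).map (algebraMap (Fp L) L)))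
      (h : HA L e dV hdV dW hdW) (v : (kindWFinset L e dV hdV dW hdW T₀ (S : Matrix (Fin 2) (Fin 2) L) h)) (s : ℂ)
      (y k : UnitaryGroup.localPi L (IsCMField.complexConj L) (2 + 2) (hermD L e dV hdV dW hdW) v.1),
      (∀ w : UnitaryGroup.PlacesOver L v.1,
        (k : UnitaryGroup.LocalGLPi L (2 + 2) v.1) w ∈ congruenceGL (2 + 2) (valuation (w.1.adicCompletion L) (ϖ w.1) ^ cL w.1)) →
      FvT j S h v s (y * k) = FvT j S h v s y)
    -- the (ι) letters: local heights, the ball exponent, ball ⇒ level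
    (A : HA L e dV hdV dW hdW → HeightOneSpectrum (𝓞 L) → ℕ) (a₀ : HA L e dV hdV dW hdW → HeightOneSpectrum (𝓞 (Fp L)) → ℤ)
    (hA : ∀ (h : HA L e dV hdV dW hdW) (w : HeightOneSpectrum (𝓞 L)),
      GLn.localHeight (2 + 2) L w (h : GL (Fin (2 + 2)) (AdeleRing (𝓞 L) L)) ≤ ((Ideal.absNorm w.asIdeal : ℕ) : ℝ≥0) ^ A h w)
    (hball : ∀ (h : HA L e dV hdV dW hdW) (v : HeightOneSpectrum (𝓞 (Fp L))) (u₀ : ↥(unipDeltaLoc L e dV hdV dW hdW v)),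
      u₀ ∈ kindWLocalBall L e dV hdV dW hdW v (π v) (a₀ h v) →
      ∀ w : UnitaryGroup.PlacesOver L v,
        ((u₀ : UnitaryGroup.localPi L (IsCMField.complexConj L) (2 + 2) (hermD L e dV hdV dW hdW) v) : UnitaryGroup.LocalGLPi L (2 + 2) v) w ∈
          congruenceGL (2 + 2) (valuation (w.1.adicCompletion L) (ϖ w.1) ^ (cL w.1 + 2 * A h w.1))) :
    ∀ (j : Fin m) (S : skewMatrices ((IsCMField.complexConj L : L ≃ₐ[Fp L] L) : L →+* L) ((gramR L e dV hdV dW hdW).map (algebraMap (Fp L) L)))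
      (h : HA L e dV hdV dW hdW) (v : HeightOneSpectrum (𝓞 (Fp L))) (hv : v ∈ kindWFinset L e dV hdV dW hdW T₀ (S : Matrix (Fin 2) (Fin 2) L) h) (s : ℂ)
      (y u₀ : ↥(unipDeltaLoc L e dV hdV dW hdW v)), u₀ ∈ kindWLocalBall L e dV hdV dW hdW v (π v) (a₀ h v) →
      FvT j S h ⟨v, hv⟩ s (UnitaryGroup.evalPlace (Fp L) L (IsCMField.complexConj L) (2 + 2) (hermD L e dV hdV dW hdW) v (UnitaryGroup.finPart (Fp L) L (IsCMField.complexConj L) (2 + 2) (hermD L e dV hdV dW hdW) (weylDelta L e dV hdV dW hdW)) *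
              ((y * u₀ : ↥(unipDeltaLoc L e dV hdV dW hdW v)) : UnitaryGroup.localPi L (IsCMField.complexConj L) (2 + 2) (hermD L e dV hdV dW hdW) v) * UnitaryGroup.evalPlace (Fp L) L (IsCMField.complexConj L) (2 + 2) (hermD L e dV hdV dW hdW) v (UnitaryGroup.finPart (Fp L) L (IsCMField.complexConj L) (2 + 2) (hermD L e dV hdV dW hdW) h)) =
      FvT j S h ⟨v, hv⟩ s (UnitaryGroup.evalPlace (Fp L) L (IsCMField.complexConj L) (2 + 2) (hermD L e dV hdV dW hdW) v (UnitaryGroup.finPart (Fp L) L (IsCMField.complexConj L) (2 + 2) (hermD L e dV hdV dW hdW) (weylDelta L e dV hdV dW hdW)) *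
              ((y : ↥(unipDeltaLoc L e dV hdV dW hdW v)) : UnitaryGroup.localPi L (IsCMField.complexConj L) (2 + 2) (hermD L e dV hdV dW hdW) v) * UnitaryGroup.evalPlace (Fp L) L (IsCMField.complexConj L) (2 + 2) (hermD L e dV hdV dW hdW) v (UnitaryGroup.finPart (Fp L) L (IsCMField.complexConj L) (2 + 2) (hermD L e dV hdV dW hdW) h)) := by
  intro j S h v hv s y u₀ hu₀
  -- `W_v·ι(y u₀)·h_v = (W_v·ι(y))·ι(u₀)·h_v`, then ★ p863964 §4 at `y := W_v·ι(y)`, `k := ι(u₀)`, `x := h`, `a := A h`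
  rw [Subgroup.coe_mul, ← mul_assoc]
  exact FvT_mul_mul_evalPlace_eq L e dV hdV dW hdW FvT ϖ hϖ cL hlevInv j S h ⟨v, hv⟩ s h (fun w => A h w.1) (fun w => hA h w.1) _ _ (hball h v u₀ hu₀)

/-! ## §2 HEAD: the (iii-fin) letters `Tc c hc hsuppLoc k₂ k₃ Tβ hsizeLoc` of the KIND-W head, packaged -/

set_option maxHeartbeats 800000 in -- MEASURED: the statement concatenates ★ p863720's `hstab`∕`hsup`∕`hsizeLoc` blocks (800 000 there) with the level data and the two slot blocks — `whnf` of the binders, no search tactics; 400 000 fails, 800 000 passes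
include hdV0 hdW0 in
/-- **THE (iii-fin) LETTERS OF RECORD, PACKAGED.**  Frame `n = 2` (`e : Fin N × Fin M ≃ Fin 2`), the carriers `T₀, νv` (Haar, `hνh`) of the KIND-W head, uniformisers `π_v` of `L⁺`
(`hπ`), the local factor families `FvT` and the finite letter `Ffin` in the GUARDED reading of record (`hreadF`).  BY VALUE: the level `(ϖ, hϖ, cL, hlevInv)` of the reading
(★ p863964 §3's output); the (ι) letters `A a₀ lev Tδ₀ δ₀ hδ₀ k hlev hA ha₀ hball` (K2Liu-p13 (g5)); the per-place letters (R) `Tρ ρ hρ a₁ a₂ a₃ hstab`,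
(B) `b₁ Tβ hsup` (★ p863720's binders verbatim); the carriers' normalisation `hνK` (the head's conjunct) pays (V) through ★ p864002.  THEN the remaining (iii-fin) letters of ★ p863724 `kindW_block_cm_of_localLetters_haar` (:145–:161 at `n := 2`, `Ffin` the tie's):
`∃ Tc c, (∀ w ∉ Tc, c w = 0) ∧ hsuppLoc ∧ ∃ k₂ k₃ Tβ, hsizeLoc` — `(Tc, c)` := ★ (θ)'s conductor ∕ defect exponents, `hsuppLoc` := ★ p863876 ∘ §1 ∘ (★ (ζ) ∘ ★ (θ)), `k₂ := (dν + b₁)·a₂`,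
`k₃ := (dν + b₁)·a₃`, `Tβ := Tβ ∪ Tν ∪ Tρ ∪ Tδ₀`, `hsizeLoc` := ★ p863720.
[cite: KudlaRallis1994, §2] [cite: Shimura1997, §18.4 Prop. 18.14] [cite: Casselman1980, §3] [cite: BorelJacquet1979, §1.2, §4.1] [cite: Tate1950, §2.2] -/
theorem kindW_finite_letters_of_record
    (T₀ : Finset (HeightOneSpectrum (𝓞 (Fp L))))
    (νv : ∀ v : HeightOneSpectrum (𝓞 (Fp L)), Measure ↥(unipDeltaLoc L e dV hdV dW hdW v)) (hνh : ∀ v, (νv v).IsHaarMeasure)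
    {π : ∀ v : HeightOneSpectrum (𝓞 (Fp L)), v.adicCompletion (Fp L)} (hπ : ∀ v, Valued.v (π v) = WithZero.exp (-1 : ℤ)) {m : ℕ}
    (FvT : Fin m → ∀ (S : skewMatrices ((IsCMField.complexConj L : L ≃ₐ[Fp L] L) : L →+* L) ((gramR L e dV hdV dW hdW).map (algebraMap (Fp L) L)))
      (h : HA L e dV hdV dW hdW) (v : (kindWFinset L e dV hdV dW hdW T₀ (S : Matrix (Fin 2) (Fin 2) L) h)),
      ℂ → UnitaryGroup.localPi L (IsCMField.complexConj L) (2 + 2) (hermD L e dV hdV dW hdW) v.1 → ℂ)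
    (Ffin : Fin m → skewMatrices ((IsCMField.complexConj L : L ≃ₐ[Fp L] L) : L →+* L) ((gramR L e dV hdV dW hdW).map (algebraMap (Fp L) L)) → HA L e dV hdV dW hdW →
      HeightOneSpectrum (𝓞 (Fp L)) → ℂ → ℂ)
    (hreadF : ∀ (j : Fin m) (S : skewMatrices ((IsCMField.complexConj L : L ≃ₐ[Fp L] L) : L →+* L) ((gramR L e dV hdV dW hdW).map (algebraMap (Fp L) L)))
      (h : HA L e dV hdV dW hdW) (v : HeightOneSpectrum (𝓞 (Fp L))) (s : ℂ),
      Ffin j S h v s = if (S : Matrix (Fin 2) (Fin 2) L).det = 0 then 0 else kindWFfin L e dV hdV dW hdW T₀ νv π FvT j S h v s)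
    -- the level of the reading (★ p863964 §3's output, by value)
    (ϖ : (w : HeightOneSpectrum (𝓞 L)) → w.adicCompletion L) (hϖ : ∀ w, Valued.v (ϖ w) = WithZero.exp (-1 : ℤ)) (cL : HeightOneSpectrum (𝓞 L) → ℕ)
    (hlevInv : ∀ (j : Fin m) (S : skewMatrices ((IsCMField.complexConj L : L ≃ₐ[Fp L] L) : L →+* L) ((gramR L e dV hdV dW hdW).map (algebraMap (Fp L) L)))
      (h : HA L e dV hdV dW hdW) (v : (kindWFinset L e dV hdV dW hdW T₀ (S : Matrix (Fin 2) (Fin 2) L) h)) (s : ℂ)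
      (y k : UnitaryGroup.localPi L (IsCMField.complexConj L) (2 + 2) (hermD L e dV hdV dW hdW) v.1),
      (∀ w : UnitaryGroup.PlacesOver L v.1,
        (k : UnitaryGroup.LocalGLPi L (2 + 2) v.1) w ∈ congruenceGL (2 + 2) (valuation (w.1.adicCompletion L) (ϖ w.1) ^ cL w.1)) →
      FvT j S h v s (y * k) = FvT j S h v s y)
    -- the (ι) letters (K2Liu-p13 (g5) `exists_levelLetters`, by value)
    (A : HA L e dV hdV dW hdW → HeightOneSpectrum (𝓞 L) → ℕ) (a₀ : HA L e dV hdV dW hdW → HeightOneSpectrum (𝓞 (Fp L)) → ℤ)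
    (lev : HA L e dV hdV dW hdW → HeightOneSpectrum (𝓞 L) → ℕ) (Tδ₀ : Finset (HeightOneSpectrum (𝓞 L))) (δ₀ : HeightOneSpectrum (𝓞 L) → ℕ) (hδ₀ : ∀ w ∉ Tδ₀, δ₀ w = 0) (k : ℕ)
    (hlev : ∀ (h : HA L e dV hdV dW hdW) (w : HeightOneSpectrum (𝓞 L)),
      ((Ideal.absNorm w.asIdeal : ℕ) : ℝ) ^ lev h w ≤ ((Ideal.absNorm w.asIdeal : ℕ) : ℝ) ^ δ₀ w * (GLn.localHeight (2 + 2) L w (h : GL (Fin (2 + 2)) (AdeleRing (𝓞 L) L)) : ℝ) ^ k)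
    (hA : ∀ (h : HA L e dV hdV dW hdW) (w : HeightOneSpectrum (𝓞 L)),
      GLn.localHeight (2 + 2) L w (h : GL (Fin (2 + 2)) (AdeleRing (𝓞 L) L)) ≤ ((Ideal.absNorm w.asIdeal : ℕ) : ℝ≥0) ^ A h w)
    (ha₀ : ∀ (h : HA L e dV hdV dW hdW) (v : HeightOneSpectrum (𝓞 (Fp L))) (w : UnitaryGroup.PlacesOver L v),
      (v.asIdeal.ramificationIdx' w.1.asIdeal : ℤ) * a₀ h v ≤ (lev h w.1 : ℤ))
    (hball : ∀ (h : HA L e dV hdV dW hdW) (v : HeightOneSpectrum (𝓞 (Fp L))) (u₀ : ↥(unipDeltaLoc L e dV hdV dW hdW v)),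
      u₀ ∈ kindWLocalBall L e dV hdV dW hdW v (π v) (a₀ h v) →
      ∀ w : UnitaryGroup.PlacesOver L v,
        ((u₀ : UnitaryGroup.localPi L (IsCMField.complexConj L) (2 + 2) (hermD L e dV hdV dW hdW) v) : UnitaryGroup.LocalGLPi L (2 + 2) v) w ∈
          congruenceGL (2 + 2) (valuation (w.1.adicCompletion L) (ϖ w.1) ^ (cL w.1 + 2 * A h w.1)))
    -- (V) the Haar-volume letter is PAID by ★ p864002 `hvol_of_haar` from the carriers' normalisation `hνK` (the head's first carrier conjunct, :84–:85 at `n := 2`)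
    (hνK : ∀ v, νv v (((inH (fun v => UnitaryGroup.localInt L (IsCMField.complexConj L) (2 + 2) (hermD L e dV hdV dW hdW) v)
      (fun v => unipDeltaLoc L e dV hdV dW hdW v) v) : Subgroup (unipDeltaLoc L e dV hdV dW hdW v)) : Set (unipDeltaLoc L e dV hdV dW hdW v)) = 1)
    -- (R) radius-stability of the ball integrals of the integrand of record
    (Tρ : Finset (HeightOneSpectrum (𝓞 L))) (ρ : HeightOneSpectrum (𝓞 L) → ℕ) (hρ : ∀ w ∉ Tρ, ρ w = 0) (a₁ a₂ a₃ : ℕ)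
    (hstab : ∀ (j : Fin m) (S : skewMatrices ((IsCMField.complexConj L : L ≃ₐ[Fp L] L) : L →+* L) ((gramR L e dV hdV dW hdW).map (algebraMap (Fp L) L)))
      (h : HA L e dV hdV dW hdW) (v : (kindWFinset L e dV hdV dW hdW T₀ (S : Matrix (Fin 2) (Fin 2) L) h)), (S : Matrix (Fin 2) (Fin 2) L).det ≠ 0 →
      ∀ (s : ℂ) (dS dA : HeightOneSpectrum (𝓞 L) → ℕ),
      (∀ (w : UnitaryGroup.PlacesOver L v.1) (a b : Fin 2), Valued.v ((((S : Matrix (Fin 2) (Fin 2) L) a b : L)) : w.1.adicCompletion L) ≤ WithZero.exp ((dS w.1 : ℕ) : ℤ)) →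
      (∀ (w : UnitaryGroup.PlacesOver L v.1) (a b : Fin 2), Valued.v ((((S : Matrix (Fin 2) (Fin 2) L)⁻¹ a b : L)) : w.1.adicCompletion L) ≤ WithZero.exp ((dA w.1 : ℕ) : ℤ)) →
      ∃ R : ℕ, R ≤ ∑ w : UnitaryGroup.PlacesOver L v.1, (ρ w.1 + a₁ * lev h w.1 + a₂ * dS w.1 + a₃ * dA w.1) ∧
        ∀ k' : ℕ, R ≤ k' →
          ∫ y in kindWLocalBall L e dV hdV dW hdW v.1 (π v.1) (-(k' : ℤ)),
            conj (unipDeltaChar L e dV hdV dW hdW (S : Matrix (Fin 2) (Fin 2) L)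
                (locToAdelic L e dV hdV dW hdW v.1
                  ((y : ↥(unipDeltaLoc L e dV hdV dW hdW v.1)) : UnitaryGroup.localPi L (IsCMField.complexConj L) (2 + 2) (hermD L e dV hdV dW hdW) v.1)) : ℂ) *
              FvT j S h v s (UnitaryGroup.evalPlace (Fp L) L (IsCMField.complexConj L) (2 + 2) (hermD L e dV hdV dW hdW) v.1
                    (UnitaryGroup.finPart (Fp L) L (IsCMField.complexConj L) (2 + 2) (hermD L e dV hdV dW hdW) (weylDelta L e dV hdV dW hdW)) *
                  ((y : ↥(unipDeltaLoc L e dV hdV dW hdW v.1)) : UnitaryGroup.localPi L (IsCMField.complexConj L) (2 + 2) (hermD L e dV hdV dW hdW) v.1) *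
                  UnitaryGroup.evalPlace (Fp L) L (IsCMField.complexConj L) (2 + 2) (hermD L e dV hdV dW hdW) v.1
                    (UnitaryGroup.finPart (Fp L) L (IsCMField.complexConj L) (2 + 2) (hermD L e dV hdV dW hdW) h)) ∂(νv v.1) =
          ∫ y in kindWLocalBall L e dV hdV dW hdW v.1 (π v.1) (-(R : ℤ)),
            conj (unipDeltaChar L e dV hdV dW hdW (S : Matrix (Fin 2) (Fin 2) L)
                (locToAdelic L e dV hdV dW hdW v.1
                  ((y : ↥(unipDeltaLoc L e dV hdV dW hdW v.1)) : UnitaryGroup.localPi L (IsCMField.complexConj L) (2 + 2) (hermD L e dV hdV dW hdW) v.1)) : ℂ) *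
              FvT j S h v s (UnitaryGroup.evalPlace (Fp L) L (IsCMField.complexConj L) (2 + 2) (hermD L e dV hdV dW hdW) v.1
                    (UnitaryGroup.finPart (Fp L) L (IsCMField.complexConj L) (2 + 2) (hermD L e dV hdV dW hdW) (weylDelta L e dV hdV dW hdW)) *
                  ((y : ↥(unipDeltaLoc L e dV hdV dW hdW v.1)) : UnitaryGroup.localPi L (IsCMField.complexConj L) (2 + 2) (hermD L e dV hdV dW hdW) v.1) *
                  UnitaryGroup.evalPlace (Fp L) L (IsCMField.complexConj L) (2 + 2) (hermD L e dV hdV dW hdW) v.1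
                    (UnitaryGroup.finPart (Fp L) L (IsCMField.complexConj L) (2 + 2) (hermD L e dV hdV dW hdW) h)) ∂(νv v.1))
    -- (B) the sup letter on `w_Δ · ball(−a) · h_v`, locally uniformly in `s`
    (b₁ : ℕ) (Tβ : Finset (HeightOneSpectrum (𝓞 L)))
    (hsup : ∀ z : ℂ, 0 < z.re → ∃ (r : ℝ) (k₁ : ℕ) (β : HeightOneSpectrum (𝓞 L) → ℕ), 0 < r ∧ (∀ w ∉ Tβ, β w = 0) ∧
      ∀ (j : Fin m) (S : skewMatrices ((IsCMField.complexConj L : L ≃ₐ[Fp L] L) : L →+* L) ((gramR L e dV hdV dW hdW).map (algebraMap (Fp L) L))) (s : ℂ),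
      dist s z < r → ∀ (h : HA L e dV hdV dW hdW) (v : (kindWFinset L e dV hdV dW hdW T₀ (S : Matrix (Fin 2) (Fin 2) L) h)) (a : ℕ)
        (y : ↥(unipDeltaLoc L e dV hdV dW hdW v.1)), y ∈ kindWLocalBall L e dV hdV dW hdW v.1 (π v.1) (-(a : ℤ)) →
        ‖FvT j S h v s (UnitaryGroup.evalPlace (Fp L) L (IsCMField.complexConj L) (2 + 2) (hermD L e dV hdV dW hdW) v.1
              (UnitaryGroup.finPart (Fp L) L (IsCMField.complexConj L) (2 + 2) (hermD L e dV hdV dW hdW) (weylDelta L e dV hdV dW hdW)) *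
            ((y : ↥(unipDeltaLoc L e dV hdV dW hdW v.1)) : UnitaryGroup.localPi L (IsCMField.complexConj L) (2 + 2) (hermD L e dV hdV dW hdW) v.1) *
            UnitaryGroup.evalPlace (Fp L) L (IsCMField.complexConj L) (2 + 2) (hermD L e dV hdV dW hdW) v.1
              (UnitaryGroup.finPart (Fp L) L (IsCMField.complexConj L) (2 + 2) (hermD L e dV hdV dW hdW) h))‖ ≤
          (∏ w : UnitaryGroup.PlacesOver L v.1,
              ((Ideal.absNorm w.1.asIdeal : ℕ) : ℝ) ^ β w.1 * (GLn.localHeight (2 + 2) L w.1 (h : GL (Fin (2 + 2)) (AdeleRing (𝓞 L) L)) : ℝ) ^ k₁) *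
            ((Ideal.absNorm v.1.asIdeal : ℕ) : ℝ) ^ (b₁ * a)) :
    ∃ (Tc : Finset (HeightOneSpectrum (𝓞 L))) (c : HeightOneSpectrum (𝓞 L) → ℕ), (∀ w ∉ Tc, c w = 0) ∧
      (∀ (v : HeightOneSpectrum (𝓞 (Fp L))) (j : Fin m)
          (S : skewMatrices ((IsCMField.complexConj L : L ≃ₐ[Fp L] L) : L →+* L) ((gramR L e dV hdV dW hdW).map (algebraMap (Fp L) L))) (s : ℂ) (h : HA L e dV hdV dW hdW),
          v ∈ kindWFinset L e dV hdV dW hdW T₀ (S : Matrix (Fin 2) (Fin 2) L) h → 0 < s.re → Ffin j S h v s ≠ 0 →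
          ∀ (w : UnitaryGroup.PlacesOver L v) (a b : Fin 2),
            Valued.v ((((S : Matrix (Fin 2) (Fin 2) L) a b : L)) : w.1.adicCompletion L) ≤ WithZero.exp (((lev h w.1 + c w.1 : ℕ) : ℤ))) ∧
      ∃ (k₂ k₃ : ℕ) (Tβ' : Finset (HeightOneSpectrum (𝓞 L))),
        ∀ z : ℂ, 0 < z.re → ∃ (r : ℝ) (k₁ : ℕ) (β : HeightOneSpectrum (𝓞 L) → ℕ), 0 < r ∧ (∀ w ∉ Tβ', β w = 0) ∧
          ∀ (j : Fin m) (S : skewMatrices ((IsCMField.complexConj L : L ≃ₐ[Fp L] L) : L →+* L) ((gramR L e dV hdV dW hdW).map (algebraMap (Fp L) L))) (s : ℂ),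
          dist s z < r → ∀ (h : HA L e dV hdV dW hdW) (v : HeightOneSpectrum (𝓞 (Fp L))), v ∈ kindWFinset L e dV hdV dW hdW T₀ (S : Matrix (Fin 2) (Fin 2) L) h →
          ∀ (dS dA : HeightOneSpectrum (𝓞 L) → ℕ),
            (∀ (w : UnitaryGroup.PlacesOver L v) (a b : Fin 2), Valued.v ((((S : Matrix (Fin 2) (Fin 2) L) a b : L)) : w.1.adicCompletion L) ≤ WithZero.exp ((dS w.1 : ℕ) : ℤ)) →
            (∀ (w : UnitaryGroup.PlacesOver L v) (a b : Fin 2), Valued.v ((((S : Matrix (Fin 2) (Fin 2) L)⁻¹ a b : L)) : w.1.adicCompletion L) ≤ WithZero.exp ((dA w.1 : ℕ) : ℤ)) →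
            ‖Ffin j S h v s‖ ≤ ∏ w : UnitaryGroup.PlacesOver L v,
              ((Ideal.absNorm w.1.asIdeal : ℕ) : ℝ) ^ β w.1 * (GLn.localHeight (2 + 2) L w.1 (h : GL (Fin (2 + 2)) (AdeleRing (𝓞 L) L)) : ℝ) ^ k₁ *
                ((Ideal.absNorm w.1.asIdeal : ℕ) : ℝ) ^ (k₂ * dS w.1 + k₃ * dA w.1) := by
  -- (V): ★ p864002 from the normalisation `hνK` of the Haar carriers
  haveI : ∀ v, (νv v).IsHaarMeasure := hνh
  obtain ⟨Tν, ρν, dν, hρν, hvol⟩ := hvol_of_haar L e dV hdV dW hdW νv hνK hπ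
  -- (θ): conductor ∕ defect exponents of record, `T^R_{kk} ≠ 0` by ★ `gramR_apply_ne_zero`
  have hg : ∀ k : Fin 2, gramR L e dV hdV dW hdW k k ≠ 0 := fun k => gramR_apply_ne_zero L e dV hdV hdV0 dW hdW hdW0 k
  obtain ⟨d, D, Tc, c, hd, hDg, hDδ, hc, h5⟩ := exists_conductorLetters L e dV hdV dW hdW hg
  -- (ζ): the dual-lattice letter from (θ)'s numeric letter and the (ι) reading `ha₀`
  have hdual := hdual_of_exponent_letter L e dV hdV dW hdW hπ d hd hg D hDg hDδ lev c a₀ (hdom_of_conductorLetters L h5 lev a₀ ha₀)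
  -- §1: the level-invariance letter; ★ p863876 at the guarded reading; `hreadF` at the `≠ 0` premise
  have hsuppG := hsuppLoc_of_level_guarded L e dV hdV dW hdW T₀ νv (fun v => (hνh v).toIsMulLeftInvariant) hπ FvT lev c a₀
    (hFinv_of_levelLetters L e dV hdV dW hdW T₀ π FvT ϖ hϖ cL hlevInv A a₀ hA hball) hdual
  refine ⟨Tc, c, hc, fun v j S s h hv hs hne => hsuppG v j S s h hv hs (by rw [← hreadF]; exact hne),
    (dν + b₁) * a₂, (dν + b₁) * a₃, Tβ ∪ Tν ∪ Tρ ∪ Tδ₀, ?_⟩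
  -- ★ p863720
  exact hsizeLoc_of_place L e dV hdV dW hdW T₀ νv π FvT Ffin hreadF lev Tδ₀ δ₀ hδ₀ k hlev Tν ρν hρν dν hvol Tρ ρ hρ a₁ a₂ a₃ hstab b₁ Tβ hsup

end Summit.HodgeConjecture.HodgeConjecture.Cruxes.HLiu418.K2LiuKindWFiniteLettersOfRecord

end
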